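import Mathlib
import HarnessLib
import Summits.ValiantsHypothesis.ValiantsHypothesis.Theorems.MonotoneRestorationOrbitRestorationQPEigenFreeTransport
import Summits.ValiantsHypothesis.ValiantsHypothesis.Theorems.MonotoneRestorationOrbitRestorationQPStableLocalPolyUFactors

/-!
# Block-untwisted families of local forms have narrow products (SPAN currency; the abstract block theorem)

Route MonotoneRestoration, crux `OrbitRestorationQP` (stmt-ValiantsHypothesis-18293), SPAN-currency lane of the open
sub-rung A_∞ (`stub_sigmaPiSigmaValue`), `ΠΣ` part, twisted residue.  Helper (`--supports`), def-free.

The twisted residue of the `ΠΣ` sub-rung (families with eigen-factors, `…EigenFree.lean`) is organised by BLOCKS: the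
product `B_l` of the factors of a matrix-symmetric affine product carrying a given pair `l = (R, C)` of row/column
supports.  Blocks are placed polynomial local forms with `U` (each factor is `β₀ + δU + local atoms`,
`LocalFormShape`), they are transported up to units along the support action (`…BlockTransport.lean`), and the only
possible block eigen-scalars are SIGNS (characters of `Sym(R) × Sym(C)`).  This file proves the abstract assembly:

* **`prod_mem_narrowSpan_of_blockUntwisted`** — a finite family `(B_l)` of nonzero placed polynomial local forms with
  `U` (cores `r_l + c_l + 1 ≤ w`) which every row/column renaming transports UP TO UNITS along permutations `κ σ τ` of
  the index set, and which is BLOCK-UNTWISTED (`(σ,τ) · B_l = c · B_l ⇒ c = 1`), has `Π_l B_l ∈ span_ℂ {hom_{F,n} : tw F ≤ w}`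
  — polynomial orbits.  Proof: cocycle trivialisation (`NormalisedFactors.exists_rescaling_of_eigenFree_transport`)
  makes the rescaled family exactly permuted, and `CorePatterns.prod_mem_narrowSpan_of_stable_localPolyUFactors` applies.

Remaining for the block-untwisted case of span-A₁ (next hand): the bookkeeping from
`LocalFactors.exists_rowColSupports_of_matrixSymmetric` + `LocalFormShape` to this theorem's hypotheses (blocks as
`aeval` of a polynomial in the atoms at the canonical placement of their supports; `κ σ τ (R, C) = (σ • R, τ • C)`).
The complementary SIGN-TWISTED blocks (a transposition inside a support negates the block, e.g. the column Vandermonde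
factors `x_{aq} − x_{a'q}`) are the genuine residue (square roots in span currency; template `…ColumnVandermondesNarrow`).
No registered stub is closed; the crux and VP ≠ VNP are not moved. [folklore]
-/

noncomputable section

-- `Summit.ValiantsHypothesis.ValiantsHypothesis.…` is the tree's single-conjunct layout (Sub = Summit).
set_option linter.dupNamespace false

namespace Summit.ValiantsHypothesis.ValiantsHypothesis.Theorems

namespace NormalisedFactors

open MvPolynomial Finset Equiv ProductAction
open Literature.Computability.AlgebraicComplexity (homPoly)
open Literature.Combinatorics.SimpleGraph (treewidth)

variable {n : ℕ}

/-- **THE ABSTRACT BLOCK THEOREM.**  A block-untwisted finite family of nonzero placed polynomial local forms with `U`,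
transported up to units along permutations of its index set by every row/column renaming, has its product in
`span_ℂ {hom_{F,n} : tw F ≤ w}`. [folklore; cite: DwivediPagoSeppelt2026, §8] -/
theorem prod_mem_narrowSpan_of_blockUntwisted (n w : ℕ) {J : Type} [Fintype J]
    (B : J → MvPolynomial (Fin n × Fin n) ℂ) (hB0 : ∀ l, B l ≠ 0) (κ : Perm (Fin n) → Perm (Fin n) → Perm J)
    (hassoc : ∀ (σ τ : Perm (Fin n)) (l : J), ∃ c : ℂ, c ≠ 0 ∧
      rename (fun P : Fin n × Fin n => (σ P.1, τ P.2)) (B l) = C c * B (κ σ τ l))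
    (heigen : ∀ (σ τ : Perm (Fin n)) (l : J) (c : ℂ),
      rename (fun P : Fin n × Fin n => (σ P.1, τ P.2)) (B l) = C c * B l → c = 1)
    (hloc : ∀ l, ∃ (r c : ℕ) (eR : Fin r → Fin n) (eC : Fin c → Fin n)
      (P : MvPolynomial (((Fin r × Fin c) ⊕ (Fin r ⊕ Fin c)) ⊕ Unit) ℂ), r + c + 1 ≤ w ∧ Function.Injective eR ∧
      Function.Injective eC ∧
      B l = aeval (Sum.elim (Sum.elim (fun ab : Fin r × Fin c => (X (eR ab.1, eC ab.2) : MvPolynomial (Fin n × Fin n) ℂ))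
        (Sum.elim (fun a : Fin r => ∑ j : Fin n, (X (eR a, j) : MvPolynomial (Fin n × Fin n) ℂ))
          (fun b : Fin c => ∑ j : Fin n, (X (j, eC b) : MvPolynomial (Fin n × Fin n) ℂ))))
        (fun _ : Unit => ∑ i : Fin n, ∑ j : Fin n, (X (i, j) : MvPolynomial (Fin n × Fin n) ℂ))) P) :
    (∏ l, B l) ∈ Submodule.span ℂ {p : MvPolynomial (Fin n × Fin n) ℂ |
        ∃ (a b : ℕ) (E : Multiset (Fin a × Fin b)),
          treewidth (SimpleGraph.fromRel fun u v : Fin a ⊕ Fin b =>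
            ∃ e ∈ E, u = Sum.inl e.1 ∧ v = Sum.inr e.2) ≤ w ∧ p = homPoly E n ℂ} := by
  classical
  -- cocycle trivialisation
  obtain ⟨d, hd0, hd⟩ := exists_rescaling_of_eigenFree_transport B hB0 (fun σ τ l => κ σ τ l) hassoc heigen
  set Lf : J → MvPolynomial (Fin n × Fin n) ℂ := fun l => C (d l) * B l with hLf
  have hstab : ∀ σ τ : Perm (Fin n), ∃ κ' : Perm J, ∀ l,
      rename (fun P : Fin n × Fin n => (σ P.1, τ P.2)) (Lf l) = Lf (κ' l) :=
    fun σ τ => ⟨κ σ τ, fun l => by simp only [hLf]; exact hd σ τ l⟩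
  have hloc' : ∀ l, ∃ (r c : ℕ) (eR : Fin r → Fin n) (eC : Fin c → Fin n)
      (P : MvPolynomial (((Fin r × Fin c) ⊕ (Fin r ⊕ Fin c)) ⊕ Unit) ℂ), r + c + 1 ≤ w ∧ Function.Injective eR ∧
      Function.Injective eC ∧
      Lf l = aeval (Sum.elim (Sum.elim (fun ab : Fin r × Fin c => (X (eR ab.1, eC ab.2) : MvPolynomial (Fin n × Fin n) ℂ))
        (Sum.elim (fun a : Fin r => ∑ j : Fin n, (X (eR a, j) : MvPolynomial (Fin n × Fin n) ℂ))
          (fun b : Fin c => ∑ j : Fin n, (X (j, eC b) : MvPolynomial (Fin n × Fin n) ℂ))))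
        (fun _ : Unit => ∑ i : Fin n, ∑ j : Fin n, (X (i, j) : MvPolynomial (Fin n × Fin n) ℂ))) P := by
    intro l
    obtain ⟨r, c, eR, eC, P, hw, heR, heC, hP⟩ := hloc l
    refine ⟨r, c, eR, eC, C (d l) * P, hw, heR, heC, ?_⟩
    simp only [hLf]
    rw [map_mul, aeval_C, algebraMap_eq, hP]
  have hprod := CorePatterns.prod_mem_narrowSpan_of_stable_localPolyUFactors n w Lf hstab hloc'
  -- undo the rescaling
  set D : ℂ := ∏ l, d l with hD
  have hD0 : D ≠ 0 := Finset.prod_ne_zero_iff.2 fun l _ => hd0 l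
  have hLfprod : (∏ l, Lf l) = C D * ∏ l, B l := by
    rw [hLf, Finset.prod_mul_distrib, ← map_prod]
  have hB : (∏ l, B l) = C D⁻¹ * ∏ l, Lf l := by
    rw [hLfprod, ← mul_assoc, ← map_mul, inv_mul_cancel₀ hD0, C_1, one_mul]
  rw [hB, ← smul_eq_C_mul]
  exact Submodule.smul_mem _ _ hprod

end NormalisedFactors

end Summit.ValiantsHypothesis.ValiantsHypothesis.Theorems

end
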